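import Summits.CriticalPhenomena.SAWScalingLimit.Theorems.SAWDefectDecoherenceBoundaryClosureRDevelopingMapsCompact
import HarnessLib

/-!
# Boundary data transfer, VIII: the limit at a point (site value lemma)

Route `SAWDefectDecoherence`, crux `BoundaryClosureR` (stmt-CriticalPhenomena-14004), line
`pick-half-plane`, stub `stub_engineBoundaryData` (r13).  The analytic frame shared by the three
limit passages of the boundary data transfer: an engine limit `h` is continuous on
`U = (carrier ∪ flat pieces) ∖ {x}` and is the locally uniform limit there of the normalised
developing maps `h_δ(s) = δ (H s − H s_b)/F(b δ)` at the LATTICE SITES scaled into compacts of `U`.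
Floor sites of a pinned flat piece may lie slightly BELOW the piece (outside `U`); the site value
lemma repairs this:

* `exists_closedBall_subset_carrier` / `boundaryDataTransfer_carrierBall` (registered) — next to
  every point of `carrier ∪ flat pieces` there is a small closed ball INSIDE the carrier;
* `site_value` — for `z ∈ U` and `ε > 0` there is `θ > 0` with, eventually along the sequence,
  `‖h_δ(s) − h z‖ ≤ ε` for every potential, normaliser site and lattice site `s` within `θ` of `z`
  (equicontinuity `local_data` (EQ) + a lattice site in the closed ball of the carrier (DS) +
  convergence on that compact + continuity of `h` on `U` at `z`).
-/

noncomputable section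

open scoped Topology
open Filter Set
open Literature.Probability.LatticeModels Literature.Probability.RandomPlanarGeometry
open Literature.Probability.RandomPlanarGeometry.SAW
open Summit.CriticalPhenomena.SAWScalingLimit.Theorems.PickHalfPlane.RootWedge
open Summit.CriticalPhenomena.SAWScalingLimit.Theorems.PickHalfPlane.DevelopingMaps

namespace Summit.CriticalPhenomena.SAWScalingLimit.Theorems.PickHalfPlane.BoundaryDataTransfer

/-! ### A closed ball of the carrier next to any point of `carrier ∪ flat pieces` -/

/-- **A small closed ball of the carrier next to a point of the closed region.**  If the carrier is
the open upper half-ball inside the two pinned balls, then for every point `z` of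
`carrier ∪ flat pieces` and every `τ > 0` there is a closed ball `closedBall z' κ ⊆ carrier`
(`κ > 0`) with `dist z' z + κ ≤ τ` (at a flat point: the ball about `z + 2κ i`). [folklore] -/
theorem exists_closedBall_subset_carrier {Ω : Set ℂ} (hΩ : IsOpen Ω) {p x : ℂ} {ρ r : ℝ}
    (hflat1 : Ω ∩ Metric.ball p ρ = {z : ℂ | p.im < z.im} ∩ Metric.ball p ρ)
    (hflatx : Ω ∩ Metric.ball x r = {z : ℂ | x.im < z.im} ∩ Metric.ball x r) {z : ℂ}
    (hz : z ∈ Ω ∪ (({z : ℂ | z.im = p.im} ∩ Metric.ball p ρ) ∪ ({z : ℂ | z.im = x.im} ∩ Metric.ball x r)))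
    {τ : ℝ} (hτ : 0 < τ) :
    ∃ (z' : ℂ) (κ : ℝ), 0 < κ ∧ Metric.closedBall z' κ ⊆ Ω ∧ dist z' z + κ ≤ τ := by
  -- the flat case, for a general pinned ball
  have key : ∀ (c : ℂ) (R : ℝ), Ω ∩ Metric.ball c R = {w : ℂ | c.im < w.im} ∩ Metric.ball c R →
      z.im = c.im → z ∈ Metric.ball c R →
      ∃ (z' : ℂ) (κ : ℝ), 0 < κ ∧ Metric.closedBall z' κ ⊆ Ω ∧ dist z' z + κ ≤ τ := by
    intro c R hflat hzim hzR
    rw [Metric.mem_ball, dist_eq_norm] at hzR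
    set κ : ℝ := min (R - ‖z - c‖) τ / 4 with hκ
    have hmin : 0 < min (R - ‖z - c‖) τ := lt_min (by linarith) hτ
    have hκ0 : 0 < κ := by positivity
    have hκR : ‖z - c‖ + 4 * κ ≤ R := by have := min_le_left (R - ‖z - c‖) τ; rw [hκ]; linarith
    have hκτ : 4 * κ ≤ τ := by have := min_le_right (R - ‖z - c‖) τ; rw [hκ]; linarith
    set z' : ℂ := z + ((2 * κ : ℝ) : ℂ) * Complex.I with hz'
    have hz'z : ‖z' - z‖ = 2 * κ := by
      rw [hz', add_sub_cancel_left, norm_mul, Complex.norm_I, mul_one, Complex.norm_real,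
        Real.norm_of_nonneg (by positivity)]
    refine ⟨z', κ, hκ0, fun w hw => ?_, by rw [dist_eq_norm, hz'z]; linarith⟩
    rw [Metric.mem_closedBall, dist_eq_norm] at hw
    have hwim : c.im < w.im := by
      have h1 := Complex.abs_im_le_norm (w - z')
      rw [Complex.sub_im] at h1
      have h2 : z'.im = z.im + 2 * κ := by rw [hz']; simp
      have := (abs_le.1 (h1.trans hw)).1
      linarith
    have hwR : w ∈ Metric.ball c R := by
      rw [Metric.mem_ball, dist_eq_norm]
      have h1 : ‖w - c‖ ≤ ‖w - z‖ + ‖z - c‖ := norm_sub_le_norm_sub_add_norm_sub _ _ _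
      have h2 : ‖w - z‖ ≤ ‖w - z'‖ + ‖z' - z‖ := norm_sub_le_norm_sub_add_norm_sub _ _ _
      rw [hz'z] at h2
      linarith
    have : w ∈ {w : ℂ | c.im < w.im} ∩ Metric.ball c R := ⟨hwim, hwR⟩
    rw [← hflat] at this
    exact this.1
  rcases hz with hzΩ | ⟨hzim, hzb⟩ | ⟨hzim, hzb⟩
  · obtain ⟨κ₀, hκ₀, hsub⟩ := Metric.isOpen_iff.1 hΩ z hzΩ
    set κ : ℝ := min κ₀ τ / 2 with hκ
    have hmin : 0 < min κ₀ τ := lt_min hκ₀ hτ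
    refine ⟨z, κ, by positivity, fun w hw => hsub (Metric.mem_ball.2 ?_), ?_⟩
    · have := min_le_left κ₀ τ
      exact lt_of_le_of_lt (Metric.mem_closedBall.1 hw) (by rw [hκ]; linarith)
    · have := min_le_right κ₀ τ
      rw [dist_self, hκ]; linarith
  · exact key p ρ hflat1 hzim hzb
  · exact key x r hflatx hzim hzb

/-- **Registered helper `boundaryDataTransfer_carrierBall`** (crux stmt-CriticalPhenomena-14004, line
`pick-half-plane`, stub `stub_engineBoundaryData`): a small closed ball of the carrier next to any
point of `carrier ∪ flat pieces`, ∀-closed (`exists_closedBall_subset_carrier`). [folklore] -/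
theorem boundaryDataTransfer_carrierBall : ∀ (Ω : Set ℂ) (p x z : ℂ) (ρ r τ : ℝ), IsOpen Ω → Ω ∩ Metric.ball p ρ = {z : ℂ | p.im < z.im} ∩ Metric.ball p ρ → Ω ∩ Metric.ball x r = {z : ℂ | x.im < z.im} ∩ Metric.ball x r → z ∈ Ω ∪ (({z : ℂ | z.im = p.im} ∩ Metric.ball p ρ) ∪ ({z : ℂ | z.im = x.im} ∩ Metric.ball x r)) → 0 < τ → ∃ (z' : ℂ) (κ : ℝ), 0 < κ ∧ Metric.closedBall z' κ ⊆ Ω ∧ dist z' z + κ ≤ τ :=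
  fun _ _ _ _ _ _ _ hΩ h1 h2 hz hτ => exists_closedBall_subset_carrier hΩ h1 h2 hz hτ

section Frame

/-! ### The frame: an admissible family, a pinned flat root off the normaliser, the local sup law,
and a limit `h` of the normalised developing maps along a mesh sequence -/

variable {D : DobrushinDomain} {ρ : ℝ} {Λ : ℝ → Finset HexVertex} {m : ℝ → ℤ} {b : ℝ → Sym2 HexVertex}
  (hAF : 0 < ρ ∧
    D.carrier ∩ Metric.ball (D.pt 1) ρ = {z : ℂ | (D.pt 1).im < z.im} ∩ Metric.ball (D.pt 1) ρ ∧
    (∀ᶠ δ : ℝ in 𝓝[>] 0, hexDomainSimplyConnected (Λ δ) ∧ b δ ∈ hexDomainBoundary (Λ δ) ∧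
      (hexGraph.induce ((Λ δ : Finset HexVertex) : Set HexVertex)).Preconnected ∧
      (∀ v ∈ Λ δ, (δ : ℂ) * hexCenter v ∈ D.carrier) ∧
      (∀ v : HexVertex, (δ : ℂ) * hexCenter v ∈ Metric.ball (D.pt 1) ρ →
        (v ∈ Λ δ ↔ m δ ≤ v.1 1))) ∧
    (∀ K : Set ℂ, IsCompact K → K ⊆ D.carrier →
      ∀ᶠ δ : ℝ in 𝓝[>] 0, ∀ v : HexVertex, (δ : ℂ) * hexCenter v ∈ K → v ∈ Λ δ) ∧
    Tendsto (fun δ : ℝ => (δ : ℂ) * hexMidpoint (b δ)) (𝓝[>] 0) (𝓝 (D.pt 1)))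
  {x : ℂ} {e : ℝ → Sym2 HexVertex} {r : ℝ} {mr : ℝ → ℤ}
  (hPR : 0 < r ∧ D.carrier ∩ Metric.ball x r = {z : ℂ | x.im < z.im} ∩ Metric.ball x r ∧
    (∀ᶠ δ : ℝ in 𝓝[>] 0, e δ ∈ hexDomainBoundary (Λ δ) ∧
      Nonempty (HexMidEdgeSAW (Λ δ) (e δ) (b δ)) ∧
      (∀ v : HexVertex, (δ : ℂ) * hexCenter v ∈ Metric.ball x r → (v ∈ Λ δ ↔ mr δ ≤ v.1 1))) ∧
    Tendsto (fun δ : ℝ => (δ : ℂ) * hexMidpoint (e δ)) (𝓝[>] 0) (𝓝 x))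
  (hx : x ≠ D.pt 1)
  (hSup : ∀ K : Set ℂ, IsCompact K →
    K ⊆ D.carrier ∪ (({z : ℂ | z.im = (D.pt 1).im} ∩ Metric.ball (D.pt 1) ρ) ∪
      ({z : ℂ | z.im = x.im} ∩ Metric.ball x r)) → x ∉ K →
    ∃ C : ℝ, ∀ᶠ δ : ℝ in 𝓝[>] 0, ∀ z ∈ hexDomainMidEdges (Λ δ), (δ : ℂ) * hexMidpoint z ∈ K →
      ‖hexParafermionicObservable (Λ δ) (e δ) hexCriticalFugacity (5 / 8) z‖ ≤
        C * ‖hexParafermionicObservable (Λ δ) (e δ) hexCriticalFugacity (5 / 8) (b δ)‖)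
  {ns : ℕ → ℝ} (hns : Tendsto ns atTop (𝓝[>] 0)) {h : ℂ → ℂ}
  (hcont : ContinuousOn h ((D.carrier ∪ (({z : ℂ | z.im = (D.pt 1).im} ∩ Metric.ball (D.pt 1) ρ) ∪
    ({z : ℂ | z.im = x.im} ∩ Metric.ball x r))) \ {x}))
  (hconv : ∀ K : Set ℂ, IsCompact K →
    K ⊆ (D.carrier ∪ (({z : ℂ | z.im = (D.pt 1).im} ∩ Metric.ball (D.pt 1) ρ) ∪
      ({z : ℂ | z.im = x.im} ∩ Metric.ball x r))) \ {x} →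
    ∀ ε : ℝ, 0 < ε → ∀ᶠ n : ℕ in atTop, ∀ H : Site 2 → ℂ, IsPotential (Λ (ns n)) (e (ns n)) H →
      ∀ (ub wb : HexVertex), b (ns n) = s(ub, wb) →
      ∀ sb : Site 2, sb ∈ hexFaceVertices ub → sb ∈ hexFaceVertices wb →
      ∀ s : Site 2, IsLatticeSite (Λ (ns n)) s → ((ns n : ℝ) : ℂ) * triEmbed s ∈ K →
        ‖((ns n : ℝ) : ℂ) * (H s - H sb) /
              hexParafermionicObservable (Λ (ns n)) (e (ns n)) hexCriticalFugacity (5 / 8) (b (ns n)) -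
            h (((ns n : ℝ) : ℂ) * triEmbed s)‖ < ε)

include hAF hPR hx hSup hns hcont hconv

/-- **The limit at a point (site value lemma).**  For `z` in the punctured closed region
`U = (carrier ∪ flat pieces) ∖ {x}` and `ε > 0` there is `θ > 0` such that eventually along the
mesh sequence, for every potential `H` of the root-`e δ` observable, every normaliser site `s_b`
and every LATTICE site `s` with `‖δ s − z‖ ≤ θ`, `‖δ(H s − H s_b)/F(b δ) − h z‖ ≤ ε`.  (The
equi-Lipschitz link `local_data` (EQ) at `z`, a lattice site in a small closed ball of the carrier
next to `z` (`exists_closedBall_subset_carrier`, density (DS)), the convergence on that compact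
ball, and the continuity of `h` on `U` at `z`.) [cite: DuminilCopinSmirnov2012, §4 (precompactness of the maps H_δ)] -/
theorem site_value {z : ℂ}
    (hz : z ∈ (D.carrier ∪ (({z : ℂ | z.im = (D.pt 1).im} ∩ Metric.ball (D.pt 1) ρ) ∪
      ({z : ℂ | z.im = x.im} ∩ Metric.ball x r))) \ {x}) {ε : ℝ} (hε : 0 < ε) :
    ∃ θ : ℝ, 0 < θ ∧ ∀ᶠ n : ℕ in atTop, ∀ H : Site 2 → ℂ, IsPotential (Λ (ns n)) (e (ns n)) H →
      ∀ (ub wb : HexVertex), b (ns n) = s(ub, wb) →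
      ∀ sb : Site 2, sb ∈ hexFaceVertices ub → sb ∈ hexFaceVertices wb →
      ∀ s : Site 2, IsLatticeSite (Λ (ns n)) s → ‖((ns n : ℝ) : ℂ) * triEmbed s - z‖ ≤ θ →
        ‖((ns n : ℝ) : ℂ) * (H s - H sb) /
              hexParafermionicObservable (Λ (ns n)) (e (ns n)) hexCriticalFugacity (5 / 8) (b (ns n)) -
            h z‖ ≤ ε := by
  set U : Set ℂ := (D.carrier ∪ (({z : ℂ | z.im = (D.pt 1).im} ∩ Metric.ball (D.pt 1) ρ) ∪
    ({z : ℂ | z.im = x.im} ∩ Metric.ball x r))) \ {x} with hU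
  have hxcar : x ∉ D.carrier := fun h' => by
    have h'' : x ∈ D.carrier ∩ Metric.ball x r := ⟨h', Metric.mem_ball_self hPR.1⟩
    rw [hPR.2.1] at h''
    exact lt_irrefl _ (show x.im < x.im from h''.1)
  -- (EQ) at `z`
  obtain ⟨η, B, C, hη, -, hC, hEQ, -, -⟩ := local_data hAF hPR hx hSup hz
  -- continuity of `h` within `U` at `z`
  obtain ⟨τ, hτ, hτc⟩ := Metric.continuousWithinAt_iff.1 (hcont z hz) (ε / 3) (by positivity)
  -- the auxiliary ball of the carrier next to `z`
  set τ' : ℝ := min (min τ η) (ε / (9 * (C + 1))) / 2 with hτ'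
  have hmin : 0 < min (min τ η) (ε / (9 * (C + 1))) := lt_min (lt_min hτ hη) (by positivity)
  have hτ'0 : 0 < τ' := by positivity
  have hτ'τ : 2 * τ' ≤ τ := by
    have := (min_le_left (min τ η) (ε / (9 * (C + 1)))).trans (min_le_left τ η); rw [hτ']; linarith
  have hτ'η : 2 * τ' ≤ η := by
    have := (min_le_left (min τ η) (ε / (9 * (C + 1)))).trans (min_le_right τ η); rw [hτ']; linarith
  have hτ'ε : 2 * τ' ≤ ε / (9 * (C + 1)) := by
    have := min_le_right (min τ η) (ε / (9 * (C + 1))); rw [hτ']; linarith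
  obtain ⟨z', κ, hκ, hKΩ, hz'κ⟩ :=
    exists_closedBall_subset_carrier D.isOpen hAF.2.1 hPR.2.1 hz.1 hτ'0
  have hz'U : z' ∈ U := ⟨Or.inl (hKΩ (Metric.mem_closedBall_self hκ.le)), fun h' => hxcar (by
    rw [show z' = x from h'] at hKΩ; exact hKΩ (Metric.mem_closedBall_self hκ.le))⟩
  have hKU : Metric.closedBall z' κ ⊆ U := fun w hw => ⟨Or.inl (hKΩ hw), fun h' => hxcar (by
    rw [show w = x from h'] at hw; exact hKΩ hw)⟩
  -- (DS) at `z'` and the convergence on the compact ball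
  obtain ⟨-, -, -, -, -, -, -, -, hDS⟩ := local_data hAF hPR hx hSup hz'U
  have hcv := hconv (Metric.closedBall z' κ) (isCompact_closedBall z' κ) hKU (ε / 3) (by positivity)
  have hδev : ∀ᶠ δ : ℝ in 𝓝[>] 0, δ ∈ Set.Ioo 0 τ' := Ioo_mem_nhdsGT hτ'0
  refine ⟨τ', hτ'0, ?_⟩
  filter_upwards [hns.eventually hEQ, hns.eventually (hDS κ hκ), hcv, hns.eventually hδev] with n hEQn
    ⟨t, htl, htz'⟩ hcvn ⟨hδ0, hδτ'⟩ H hH ub wb hb sb hsbu hsbw s hsl hsz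
  set δ : ℝ := ns n with hδ
  set Fb := hexParafermionicObservable (Λ δ) (e δ) hexCriticalFugacity (5 / 8) (b δ) with hFb
  -- the auxiliary lattice site `t` in the ball
  have htK : (δ : ℂ) * triEmbed t ∈ Metric.closedBall z' κ := by
    rw [Metric.mem_closedBall, dist_eq_norm]; exact htz'.le
  have htz : ‖(δ : ℂ) * triEmbed t - z‖ ≤ τ' := by
    calc ‖(δ : ℂ) * triEmbed t - z‖ ≤ ‖(δ : ℂ) * triEmbed t - z'‖ + ‖z' - z‖ :=
          norm_sub_le_norm_sub_add_norm_sub _ _ _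
      _ ≤ κ + dist z' z := by rw [dist_eq_norm]; linarith
      _ ≤ τ' := by linarith
  -- three pieces
  have h1 : ‖(δ : ℂ) * (H s - H t) / Fb‖ ≤ ε / 3 := by
    have hlink := hEQn H hH t s htl hsl (htz.trans (by linarith)) (hsz.trans (by linarith))
    have hdist : ‖(δ : ℂ) * triEmbed s - (δ : ℂ) * triEmbed t‖ ≤ 2 * τ' := by
      calc ‖(δ : ℂ) * triEmbed s - (δ : ℂ) * triEmbed t‖
          = ‖((δ : ℂ) * triEmbed s - z) - ((δ : ℂ) * triEmbed t - z)‖ := by ring_nf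
        _ ≤ ‖(δ : ℂ) * triEmbed s - z‖ + ‖(δ : ℂ) * triEmbed t - z‖ := norm_sub_le _ _
        _ ≤ 2 * τ' := by linarith
    have hC1 : 0 < C + 1 := by linarith
    calc ‖(δ : ℂ) * (H s - H t) / Fb‖ ≤ C * (‖(δ : ℂ) * triEmbed s - (δ : ℂ) * triEmbed t‖ + δ) := hlink
      _ ≤ (C + 1) * (3 * τ') := by
          apply mul_le_mul (by linarith) (by linarith) (by positivity) hC1.le
      _ ≤ (C + 1) * (3 * (ε / (9 * (C + 1)) / 2)) := by
          apply mul_le_mul_of_nonneg_left _ hC1.le; linarith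
      _ ≤ ε / 3 := by
          field_simp
          nlinarith
  have h2 : ‖(δ : ℂ) * (H t - H sb) / Fb - h ((δ : ℂ) * triEmbed t)‖ < ε / 3 :=
    hcvn H hH ub wb hb sb hsbu hsbw t htl htK
  have h3 : dist (h ((δ : ℂ) * triEmbed t)) (h z) < ε / 3 :=
    hτc (hKU htK) (by rw [dist_eq_norm]; linarith)
  rw [dist_eq_norm] at h3
  have e1 : (δ : ℂ) * (H s - H sb) / Fb - h z =
      (δ : ℂ) * (H s - H t) / Fb + ((δ : ℂ) * (H t - H sb) / Fb - h ((δ : ℂ) * triEmbed t)) +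
        (h ((δ : ℂ) * triEmbed t) - h z) := by ring
  rw [e1]
  calc ‖(δ : ℂ) * (H s - H t) / Fb + ((δ : ℂ) * (H t - H sb) / Fb - h ((δ : ℂ) * triEmbed t)) +
        (h ((δ : ℂ) * triEmbed t) - h z)‖
      ≤ ‖(δ : ℂ) * (H s - H t) / Fb‖ + ‖(δ : ℂ) * (H t - H sb) / Fb - h ((δ : ℂ) * triEmbed t)‖ +
        ‖h ((δ : ℂ) * triEmbed t) - h z‖ := norm_add₃_le
    _ ≤ ε / 3 + ε / 3 + ε / 3 := by linarith
    _ = ε := by ring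

end Frame

end Summit.CriticalPhenomena.SAWScalingLimit.Theorems.PickHalfPlane.BoundaryDataTransfer

end
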